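import Summits.NavierStokesRegularity.NavierStokesRegularity.Theses.FilamentSkeletonRss
import Literature.Analysis.FluidPDE.GaussianWeightedSpace
import Literature.Analysis.FluidPDE.GaussianVortexPlanarProofs
import Literature.Analysis.FluidPDE.BiotSavart2DSymmetry
import Summits.AnomalousDissipation.AnomalousDissipation.Theorems.MarginalStabilityChainStretchedVortexRowsStubCellSolvabilityTools

/-!
# Crux `CoreLinearInvertibility` (stmt-NavierStokesRegularity-17973), line `Sketch`:
# tools for stub `stub_parityTools` — reflection symmetry and linearity of the core operator

Helper file (theorems only; lands `--supports stmt-NavierStokesRegularity-17973`, ends with the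
registered sub-stub `stub_parityToolsAux`) for the stub `stub_parityTools` of the skeleton
`Cruxes/CoreLinearInvertibility/Lines/Sketch.lean`. For the linearised strained core operator
`T_{λ,R} w = L_λ w − R (v^G·∇w + (K∗w)·∇G)` (`strainedVorticityOperator`, `gaussVortexVelocity`,
`biotSavart2D`, `gaussVortexProfile` of `Literature.Analysis.FluidPDE.GaussianVortexPlanar`):

* the point reflection `S u := u ∘ (−·)` commutes with `T` (`parity_coreOp_comp_neg`), with no
  regularity assumption: `D(Su)(x) = −Du(−x)` (Mathlib `fderiv_comp_smul`), `Δ(Su)(x) = Δu(−x)`,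
  `K∗(Su)(x) = −(K∗u)(−x)` (change of variables `y ↦ −y`), and `v^G`, `∇G`, `K_{2D}` are odd
  (oddness lemmas reused from the proved Theorems file
  `Summits.AnomalousDissipation.….MarginalStabilityChainStretchedVortexRowsStubCellSolvabilityTools`,
  same planar vocabulary; CONVENTIONS §2 allows `Summits.<Any>.<Problem>.Theorems.*`);
* `T` is linear on `C²` vorticities with absolutely convergent Biot–Savart integrals
  (`parity_coreOp_lincomb`), hence for `C²_c` `w`: `T w_e = (Tw)_e`, `T w_o = (Tw)_o`
  (`parity_coreOp_evenPart`, `parity_coreOp_oddPart`), `w_e = (w + Sw)/2`, `w_o = (w − Sw)/2`;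
* for an even weight `g ≥ 0` and `g f² ∈ L¹`: `∫ g f² = ∫ g f_e² + ∫ g f_o²`
  (`parity_integral_mul_sq_eq_add`: parallelogram identity and `∫ h(−x) dx = ∫ h`).
-/

set_option linter.dupNamespace false

noncomputable section

namespace Summit.NavierStokesRegularity.NavierStokesRegularity.Theorems

open MeasureTheory Filter Topology Set
open Literature.Analysis.FluidPDE
open Summit.AnomalousDissipation.AnomalousDissipation.Theorems.MarginalStabilityChainStretchedVortexRows
open scoped InnerProductSpace Laplacian ContDiff

/-! ### The point reflection `x ↦ −x` -/

/-- `D(u ∘ (−·))(x) = −Du(−x)` (no differentiability needed). [folklore] -/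
theorem parity_fderiv_comp_neg {F : Type*} [NormedAddCommGroup F] [NormedSpace ℝ F]
    (u : EuclideanSpace ℝ (Fin 2) → F) (x : EuclideanSpace ℝ (Fin 2)) :
    fderiv ℝ (fun y => u (-y)) x = -fderiv ℝ u (-x) := by
  have h := fderiv_comp_smul (f := u) (x := x) (-1 : ℝ)
  simp only [neg_one_smul] at h
  exact h

/-- `∇(u ∘ (−·))(x) = −∇u(−x)`. [folklore] -/
theorem parity_gradient_comp_neg (u : EuclideanSpace ℝ (Fin 2) → ℝ) (x : EuclideanSpace ℝ (Fin 2)) :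
    gradient (fun y => u (-y)) x = -gradient u (-x) := by
  simp only [gradient, parity_fderiv_comp_neg u x, map_neg]

/-- `D²(u ∘ (−·))(x) = D²u(−x)`. [folklore] -/
theorem parity_fderiv_fderiv_comp_neg {F : Type*} [NormedAddCommGroup F] [NormedSpace ℝ F]
    (u : EuclideanSpace ℝ (Fin 2) → F) (x : EuclideanSpace ℝ (Fin 2)) :
    fderiv ℝ (fderiv ℝ (fun y => u (-y))) x = fderiv ℝ (fderiv ℝ u) (-x) := by
  have h1 : fderiv ℝ (fun y => u (-y)) = fun y => -fderiv ℝ u (-y) :=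
    funext fun y => parity_fderiv_comp_neg u y
  rw [h1, fderiv_fun_neg, parity_fderiv_comp_neg (fderiv ℝ u) x, neg_neg]

/-- `Δ(u ∘ (−·))(x) = (Δu)(−x)`. [folklore] -/
theorem parity_laplacian_comp_neg (u : EuclideanSpace ℝ (Fin 2) → ℝ) (x : EuclideanSpace ℝ (Fin 2)) :
    Δ (fun y => u (-y)) x = Δ u (-x) := by
  rw [InnerProductSpace.laplacian_eq_iteratedFDeriv_stdOrthonormalBasis,
    InnerProductSpace.laplacian_eq_iteratedFDeriv_stdOrthonormalBasis]
  simp only [iteratedFDeriv_two_apply, parity_fderiv_fderiv_comp_neg u x]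

/-- `(K ∗ (u ∘ (−·)))(x) = −(K ∗ u)(−x)` (change of variables `y ↦ −y` in the Bochner integral;
no integrability needed). [folklore] -/
theorem parity_biotSavart2D_comp_neg (u : EuclideanSpace ℝ (Fin 2) → ℝ) (x : EuclideanSpace ℝ (Fin 2)) :
    biotSavart2D (fun y => u (-y)) x = -biotSavart2D u (-x) := by
  unfold biotSavart2D
  rw [← integral_neg_eq_self (fun y => u (-y) • biotSavartKernel2D (x - y)) volume, ← integral_neg]
  refine integral_congr_ae (Eventually.of_forall fun y => ?_)
  simp only [neg_neg]
  rw [show x - -y = -(-x - y) by abel, biotSavartKernel2D_neg, smul_neg]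

/-- **`T_{λ,R}` commutes with the point reflection**: `T(u ∘ (−·))(x) = (Tu)(−x)` for every
`u : ℝ² → ℝ` (no regularity needed). [folklore] -/
theorem parity_coreOp_comp_neg (lam R : ℝ) (u : EuclideanSpace ℝ (Fin 2) → ℝ)
    (x : EuclideanSpace ℝ (Fin 2)) :
    strainedVorticityOperator lam (fun y => u (-y)) x -
        R * (⟪gaussVortexVelocity x, gradient (fun y => u (-y)) x⟫_ℝ +
          ⟪biotSavart2D (fun y => u (-y)) x, gradient gaussVortexProfile x⟫_ℝ) =
      strainedVorticityOperator lam u (-x) -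
        R * (⟪gaussVortexVelocity (-x), gradient u (-x)⟫_ℝ +
          ⟪biotSavart2D u (-x), gradient gaussVortexProfile (-x)⟫_ℝ) := by
  simp only [strainedVorticityOperator, parity_laplacian_comp_neg u x, parity_fderiv_comp_neg u x,
    parity_gradient_comp_neg u x, parity_biotSavart2D_comp_neg u x,
    gaussVortexVelocity_neg, gradient_gaussVortexProfile_neg,
    _root_.neg_apply, inner_neg_left, inner_neg_right, WithLp.ofLp_neg, Pi.neg_apply]
  ring

/-! ### Linearity of `T_{λ,R}` on `C²` vorticities with convergent Biot–Savart integrals -/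

/-- **`T_{λ,R}` is linear**: `T(a u + b v) = a Tu + b Tv` for `C²` `u, v` whose Biot–Savart
integrals converge absolutely. [folklore] -/
theorem parity_coreOp_lincomb (lam R a b : ℝ) {u v : EuclideanSpace ℝ (Fin 2) → ℝ}
    (hu : ContDiff ℝ 2 u) (hv : ContDiff ℝ 2 v)
    (hui : ∀ x, Integrable fun y => u y • biotSavartKernel2D (x - y))
    (hvi : ∀ x, Integrable fun y => v y • biotSavartKernel2D (x - y))
    (x : EuclideanSpace ℝ (Fin 2)) :
    strainedVorticityOperator lam (fun y => a * u y + b * v y) x -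
        R * (⟪gaussVortexVelocity x, gradient (fun y => a * u y + b * v y) x⟫_ℝ +
          ⟪biotSavart2D (fun y => a * u y + b * v y) x, gradient gaussVortexProfile x⟫_ℝ) =
      a * (strainedVorticityOperator lam u x - R * (⟪gaussVortexVelocity x, gradient u x⟫_ℝ +
          ⟪biotSavart2D u x, gradient gaussVortexProfile x⟫_ℝ)) +
      b * (strainedVorticityOperator lam v x - R * (⟪gaussVortexVelocity x, gradient v x⟫_ℝ +
          ⟪biotSavart2D v x, gradient gaussVortexProfile x⟫_ℝ)) := by
  have hΔ : Δ (fun y => a * u y + b * v y) x = a * Δ u x + b * Δ v x := by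
    have h1 : (fun y => a * u y + b * v y) = (a • u) + (b • v) := by
      funext y; simp [smul_eq_mul]
    rw [h1, ContDiffAt.laplacian_add (f₁ := a • u) (f₂ := b • v) (hu.const_smul a).contDiffAt
      (hv.const_smul b).contDiffAt, InnerProductSpace.laplacian_smul a hu.contDiffAt,
      InnerProductSpace.laplacian_smul b hv.contDiffAt]
    simp [smul_eq_mul]
  have hud : DifferentiableAt ℝ u x := (hu.differentiable two_ne_zero) x
  have hvd : DifferentiableAt ℝ v x := (hv.differentiable two_ne_zero) x
  have hD : fderiv ℝ (fun y => a * u y + b * v y) x = a • fderiv ℝ u x + b • fderiv ℝ v x := by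
    rw [fderiv_fun_add (hud.const_mul a) (hvd.const_mul b), fderiv_const_mul hud,
      fderiv_const_mul hvd]
  have hG : gradient (fun y => a * u y + b * v y) x = a • gradient u x + b • gradient v x := by
    simp only [gradient, hD, map_add, map_smul]
  have hB : biotSavart2D (fun y => a * u y + b * v y) x =
      a • biotSavart2D u x + b • biotSavart2D v x := by
    have hi1 : Integrable fun y => a • u y • biotSavartKernel2D (x - y) := (hui x).smul a
    have hi2 : Integrable fun y => b • v y • biotSavartKernel2D (x - y) := (hvi x).smul b
    unfold biotSavart2D
    simp_rw [add_smul, mul_smul]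
    rw [integral_add hi1 hi2, integral_smul, integral_smul]
  rw [strainedVorticityOperator, strainedVorticityOperator, strainedVorticityOperator, hΔ, hD, hG,
    hB]
  simp only [_root_.add_apply, _root_.FunLike.coe_smul, Pi.smul_apply,
    smul_eq_mul, inner_add_left, inner_add_right, real_inner_smul_left, real_inner_smul_right]
  ring


/-! ### `C²` compactly supported vorticities -/

/-- `u ∘ (−·)` is `Cⁿ` if `u` is. [folklore] -/
theorem parity_contDiff_comp_neg {u : EuclideanSpace ℝ (Fin 2) → ℝ} {n : WithTop ℕ∞}
    (hu : ContDiff ℝ n u) : ContDiff ℝ n fun y => u (-y) :=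
  hu.comp contDiff_neg

/-- `u ∘ (−·)` has compact support if `u` has. [folklore] -/
theorem parity_hasCompactSupport_comp_neg {u : EuclideanSpace ℝ (Fin 2) → ℝ}
    (hu : HasCompactSupport u) : HasCompactSupport fun y => u (-y) :=
  hu.comp_homeomorph (Homeomorph.neg _)

/-- The Biot–Savart integral of a continuous compactly supported density converges absolutely at
every point. [folklore] -/
theorem parity_integrable_smul_biotSavartKernel2D {u : EuclideanSpace ℝ (Fin 2) → ℝ}
    (hu : Continuous u) (huc : HasCompactSupport u) (x : EuclideanSpace ℝ (Fin 2)) :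
    Integrable fun y => u y • biotSavartKernel2D (x - y) := by
  obtain ⟨C, hC⟩ := hu.bounded_above_of_compact_support huc
  exact integrable_smul_biotSavartKernel2D (hu.integrable_of_hasCompactSupport huc)
    (fun y => by rw [← Real.norm_eq_abs]; exact hC y) x

/-- The Biot–Savart velocity of a continuous compactly supported density is bounded. [folklore] -/
theorem parity_exists_norm_biotSavart2D_le {u : EuclideanSpace ℝ (Fin 2) → ℝ}
    (hu : Continuous u) (huc : HasCompactSupport u) :
    ∃ C : ℝ, ∀ x, ‖biotSavart2D u x‖ ≤ C := by
  obtain ⟨A, hA⟩ := hu.bounded_above_of_compact_support huc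
  exact ⟨_, norm_biotSavart2D_le (hu.integrable_of_hasCompactSupport huc)
    (fun y => by rw [← Real.norm_eq_abs]; exact hA y)⟩

section EvenOdd

variable (lam R : ℝ) {w : EuclideanSpace ℝ (Fin 2) → ℝ} (hw : ContDiff ℝ 2 w)
  (hwc : HasCompactSupport w)
include hw hwc

/-- **`T w_e = (Tw)_e`**: the operator applied to the even part is the even part of `Tw`. [folklore] -/
theorem parity_coreOp_evenPart (x : EuclideanSpace ℝ (Fin 2)) :
    strainedVorticityOperator lam (fun y => (w y + w (-y)) / 2) x -
        R * (⟪gaussVortexVelocity x, gradient (fun y => (w y + w (-y)) / 2) x⟫_ℝ +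
          ⟪biotSavart2D (fun y => (w y + w (-y)) / 2) x, gradient gaussVortexProfile x⟫_ℝ) =
      ((strainedVorticityOperator lam w x - R * (⟪gaussVortexVelocity x, gradient w x⟫_ℝ +
          ⟪biotSavart2D w x, gradient gaussVortexProfile x⟫_ℝ)) +
        (strainedVorticityOperator lam w (-x) - R * (⟪gaussVortexVelocity (-x), gradient w (-x)⟫_ℝ +
          ⟪biotSavart2D w (-x), gradient gaussVortexProfile (-x)⟫_ℝ))) / 2 := by
  have hfun : (fun y => (w y + w (-y)) / 2) = fun y => (1 / 2) * w y + (1 / 2) * w (-y) := by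
    funext y; ring
  rw [hfun, parity_coreOp_lincomb lam R (1 / 2) (1 / 2) hw (parity_contDiff_comp_neg hw)
    (parity_integrable_smul_biotSavartKernel2D hw.continuous hwc)
    (parity_integrable_smul_biotSavartKernel2D (parity_contDiff_comp_neg hw).continuous
      (parity_hasCompactSupport_comp_neg hwc)) x, parity_coreOp_comp_neg lam R w x]
  ring

/-- **`T w_o = (Tw)_o`**: the operator applied to the odd part is the odd part of `Tw`. [folklore] -/
theorem parity_coreOp_oddPart (x : EuclideanSpace ℝ (Fin 2)) :
    strainedVorticityOperator lam (fun y => (w y - w (-y)) / 2) x -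
        R * (⟪gaussVortexVelocity x, gradient (fun y => (w y - w (-y)) / 2) x⟫_ℝ +
          ⟪biotSavart2D (fun y => (w y - w (-y)) / 2) x, gradient gaussVortexProfile x⟫_ℝ) =
      ((strainedVorticityOperator lam w x - R * (⟪gaussVortexVelocity x, gradient w x⟫_ℝ +
          ⟪biotSavart2D w x, gradient gaussVortexProfile x⟫_ℝ)) -
        (strainedVorticityOperator lam w (-x) - R * (⟪gaussVortexVelocity (-x), gradient w (-x)⟫_ℝ +
          ⟪biotSavart2D w (-x), gradient gaussVortexProfile (-x)⟫_ℝ))) / 2 := by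
  have hfun : (fun y => (w y - w (-y)) / 2) = fun y => (1 / 2) * w y + (-(1 / 2)) * w (-y) := by
    funext y; ring
  rw [hfun, parity_coreOp_lincomb lam R (1 / 2) (-(1 / 2)) hw (parity_contDiff_comp_neg hw)
    (parity_integrable_smul_biotSavartKernel2D hw.continuous hwc)
    (parity_integrable_smul_biotSavartKernel2D (parity_contDiff_comp_neg hw).continuous
      (parity_hasCompactSupport_comp_neg hwc)) x, parity_coreOp_comp_neg lam R w x]
  ring

end EvenOdd

/-! ### Orthogonality of even and odd parts in `L²(g dx)` for an even weight `g` -/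

/-- **Even/odd splitting of a weighted `L²` norm.** For an even weight `g ≥ 0` and `f` with
`g f² ∈ L¹`: `∫ g f² = ∫ g f_e² + ∫ g f_o²`, `f_e = (f + f∘(−·))/2`, `f_o = (f − f∘(−·))/2`
(parallelogram identity and `∫ h(−x) dx = ∫ h`). [folklore] -/
theorem parity_integral_mul_sq_eq_add {g f : EuclideanSpace ℝ (Fin 2) → ℝ}
    (hg : ∀ x, g (-x) = g x) (hg0 : ∀ x, 0 ≤ g x) (hgm : Continuous g)
    (hfm : AEStronglyMeasurable f volume) (hint : Integrable fun x => g x * f x ^ 2) :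
    ∫ x, g x * f x ^ 2 =
      (∫ x, g x * ((f x + f (-x)) / 2) ^ 2) + ∫ x, g x * ((f x - f (-x)) / 2) ^ 2 := by
  have hint' : Integrable fun x => g x * f (-x) ^ 2 := by
    have := hint.comp_neg
    simpa only [hg] using this
  have hfm' : AEStronglyMeasurable (fun x => f (-x)) volume :=
    hfm.comp_measurePreserving (Measure.measurePreserving_neg volume)
  have hsum : Integrable fun x => g x * f x ^ 2 + g x * f (-x) ^ 2 := hint.add hint'
  have he : Integrable fun x => g x * ((f x + f (-x)) / 2) ^ 2 := by
    refine hsum.mono' (hgm.aestronglyMeasurable.aemeasurable.mul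
      (((hfm.aemeasurable.add hfm'.aemeasurable).div_const 2).pow_const 2)).aestronglyMeasurable
      (Eventually.of_forall fun x => ?_)
    rw [Real.norm_eq_abs, abs_of_nonneg (mul_nonneg (hg0 x) (sq_nonneg _))]
    nlinarith [hg0 x, mul_nonneg (hg0 x) (sq_nonneg (f x - f (-x)))]
  have ho : Integrable fun x => g x * ((f x - f (-x)) / 2) ^ 2 := by
    refine hsum.mono' (hgm.aestronglyMeasurable.aemeasurable.mul
      (((hfm.aemeasurable.sub hfm'.aemeasurable).div_const 2).pow_const 2)).aestronglyMeasurable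
      (Eventually.of_forall fun x => ?_)
    rw [Real.norm_eq_abs, abs_of_nonneg (mul_nonneg (hg0 x) (sq_nonneg _))]
    nlinarith [hg0 x, mul_nonneg (hg0 x) (sq_nonneg (f x + f (-x)))]
  have hI : ∫ x, g x * f (-x) ^ 2 = ∫ x, g x * f x ^ 2 := by
    rw [← integral_neg_eq_self (fun x => g x * f x ^ 2) volume]
    simp only [hg]
  have hpar : ∀ x, g x * ((f x + f (-x)) / 2) ^ 2 + g x * ((f x - f (-x)) / 2) ^ 2 =
      (g x * f x ^ 2 + g x * f (-x) ^ 2) / 2 := fun x => by ring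
  rw [← integral_add he ho]
  simp_rw [hpar]
  rw [integral_div, integral_add hint hint', hI]
  ring

/-! ### The registered sub-stub -/

/-- **Sub-stub `stub_parityToolsAux` of crux stmt-NavierStokesRegularity-17973, line `Sketch`
(tools for `stub_parityTools`).** (i) `T_{λ,R}` commutes with the point reflection:
`T(u ∘ (−·))(x) = (Tu)(−x)` for every `u : ℝ² → ℝ`; (ii) for an even weight `g ≥ 0` and `f` with
`g f² ∈ L¹`, `∫ g f² = ∫ g f_e² + ∫ g f_o²`. [folklore] -/
theorem stub_parityToolsAux :
    (∀ (lam R : ℝ) (u : EuclideanSpace ℝ (Fin 2) → ℝ) (x : EuclideanSpace ℝ (Fin 2)),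
      strainedVorticityOperator lam (fun y => u (-y)) x -
          R * (⟪gaussVortexVelocity x, gradient (fun y => u (-y)) x⟫_ℝ +
            ⟪biotSavart2D (fun y => u (-y)) x, gradient gaussVortexProfile x⟫_ℝ) =
        strainedVorticityOperator lam u (-x) -
          R * (⟪gaussVortexVelocity (-x), gradient u (-x)⟫_ℝ +
            ⟪biotSavart2D u (-x), gradient gaussVortexProfile (-x)⟫_ℝ)) ∧
    (∀ (g f : EuclideanSpace ℝ (Fin 2) → ℝ), (∀ x, g (-x) = g x) → (∀ x, 0 ≤ g x) → Continuous g →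
      AEStronglyMeasurable f volume → Integrable (fun x => g x * f x ^ 2) →
      ∫ x, g x * f x ^ 2 =
        (∫ x, g x * ((f x + f (-x)) / 2) ^ 2) + ∫ x, g x * ((f x - f (-x)) / 2) ^ 2) :=
  ⟨parity_coreOp_comp_neg, fun _ _ hg hg0 hgm hfm hint =>
    parity_integral_mul_sq_eq_add hg hg0 hgm hfm hint⟩

end Summit.NavierStokesRegularity.NavierStokesRegularity.Theorems
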